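import Summits.BirchSwinnertonDyer.BirchSwinnertonDyer.Theorems.PrintCf2RamifiedOffTYZLevelTwoDepth
import Summits.BirchSwinnertonDyer.Rank1Residual.P2.CongruentNumberSilentEvenFiveThetaRecursion
import Summits.BirchSwinnertonDyer.Rank1Residual.P2.CongruentNumberThetaDescentBlocks
import HarnessLib

/-!
# Crux `PrintCf2.RamifiedOffTYZOfFacts` (stmt-BirchSwinnertonDyer-20509), line `offtyz-v7`, LEAD cycle 11 (cruxlead-20509 g10):
# THE TWO-PRIME SECTOR OF C⁺ IN CLOSED FORM — `P(lm) ≡ Z(lm) − c·α_m (mod torsion)`, `c` odd iff `4 ∤ 𝓛(l)`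

THEOREMS ONLY (no `def`, no named fact, no `sorry`), `--supports stmt-BirchSwinnertonDyer-20509` (stub 7 = C⁺ = item 23431).  HONEST FRAMING:
bookkeeping on Tian–Yuan–Zhang 2017 §3 AS DISPLAYED (`GenusPointData.recursion`, `epsSpec`, `thm35Main`, `scriptLSpec`), GZK by name where g3's
depth criterion is invoked, and ONE display-shaped hypothesis `h35m` = Theorem 3.5's main clause FOR THE PRIME DIVISOR `m` read inside
`ℍ′_{lm} ⊇ ℍ′_m` (g3's ρ-free form `two_smul_genusPoint_sub_smul_half_isOfFinAddOrder` at `m`: `2·P(m) ≡ u·𝓛(m)·α_m` mod torsion, `u = ±1`, `α_m` a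
half of the twisted generator of `E_m(ℚ)`; printed for every `n`, displayed by the tree only inside the package of `m` — cycle-2 diagnosis (ii)).
Nothing is asserted; C⁺ stays open; BSD is not proved by any of this.

THE SECTOR.  The first members of the jump-one class (`s(n) = 3`, `#Sel₄ = 2⁶`, `ord_{s=1} L(E_n, s) = 1`) have TWO odd prime factors:
`n = l·m`, `l ≡ 1 (mod 8)`, `m ≡ 5` or `7 (mod 8)` (Legendre types R1 = `(1, 5)` and R2 = `(1, 7)` of the census, `(l/m) = +1`; first cases
`n = 205 = 41·5`, `221 = 17·13`, cycle 4).  There Tian–Yuan–Zhang's recursion has exactly ONE lower block: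
`recursionIndex (lm) = {m}` (§2), `P(m) = Z(m)`, and `ε(m, l) = ±1` (type `≠ (5, 3)`), so

  `P(lm) = Z(lm) ∓ 𝓛(l)·Z(m)`                                                    (`P_eq_of_two_primes`, EXACT in `A(ℍ′_{lm})`).

With `𝓛(l) = 2c′` (Thm 1.1 at the prime `l ≡ 1 (mod 8)`: `𝓛(l) ≡ g(l) ≡ 0 (mod 2)`) and `2·Z(m) = 2·P(m) ≡ u·𝓛(m)·α_m` (hypothesis `h35m`):

  `P(lm) ≡ Z(lm) − c·α_m  (mod A(ℍ′_{lm})_tor)`,  `c = ±c′·u·𝓛(m)`                 (`genusPoint_two_primes_congr`, §4),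

and `c` is ODD iff `c′ = 𝓛(l)/2` is odd (`𝓛(m)` is odd for the primes `m ≡ 5, 7 (mod 8)`: Thm 1.2 at `m`, `Σ₁(m) = g(m)` odd).  Hence
(§5, with g3's `LevelTwoDepth.levelTwo_iff_twoPowDivisible_iff_half`):

  **C⁺ at `n = lm` ⟺ `depth(Z(lm) − c·α_m) = depth(Q₁)` in `A(ℍ′_{lm})/tors`**        (`levelTwo_two_primes_iff`),

and at Layer 1 (§6): `[P(lm)] = [Z(lm)]` if `4 ∣ 𝓛(l)`, `[P(lm)] = [Z(lm) − α_m]` if `4 ∤ 𝓛(l)` (classes in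
`V = A(ℍ′_{lm})/(2A + tors)`); on the VISIBLE part (`[Q₁] ≠ 0`) C⁺ ⟺ `[Z(lm)] = [Q₁]`, resp. `[Z(lm)] = [Q₁] + [α_m]`
(`levelTwo_two_primes_iff_visible_of_four_dvd` / `_of_not_four_dvd`).  WHICH TERMS SURVIVE MOD 4 (the MINT's question for the `s = 3` class,
two-prime sector): exactly the genus point `Z(lm)` of the composite and — iff the bit `4 ∤ 𝓛(l)` is on — the generator class `[α_m]` of the
prime twist `E_m`.  (Orientation, NOT used formally — `c′ = 𝓛(l)/2` is a parameter of every statement below: for the prime `l ≡ 1 (mod 8)`,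
`𝓛(l)² = #Ш_an(E_l)` in the authors' normalisation (1.1), `2 ∣ 𝓛(l)` by Thm 1.1 since `g(l) = h(−4l)/2` is even, and the next bit is the
classical quartic one: `4 ∣ g(l)` iff `8 ∣ h(−4l)` iff `l = x² + 32y²` [cite: BarrucandCohn1969, Theorem]; for the `2`-adic valuation of
`L(E_l, 1)` at this level cf. [cite: Zhao1997LowestTwoPower, Thm. 1]; the census of the line (cycle 2, types R1/R2) reads the bit as `4 ∣ g(l)`.)
What is NOT decided here (and is the beyond-print object of the line, unchanged): the class `[Z(lm)] ∈ V`, invisible to every torsion-valued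
cocycle (cycle 3).

References: [cite: TianYuanZhang2017, §3.1 (p0011 L53–L73), Thm. 3.3, Thm. 3.5 (p0011 L94–L100), Thm. 1.1, Thm. 1.2]; [cite: Darmon2004, Thm. 3.22];
[cite: SilvermanAEC2009, VIII.6, X.4.9]; tree: g3 `…LevelTwoHalfGenerator` (p665240), `…LevelTwoDepth` (p666012/p666562), bsd-monsky
`Rank1Residual/P2/…ThetaRecursion` (`ThetaDescent.dvd_prime_mul_prime_iff`, `recursionIndex_prime`), `…ThetaDescentBlocks` (`ThetaDescent.iPt_iPt`).
-/

noncomputable section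

open scoped Classical

open WeierstrassCurve WeierstrassCurve.Affine Literature.NumberTheory.EllipticCurves
  Literature.NumberTheory.EllipticCurves.TianYuanZhang2017
  Literature.NumberTheory.EllipticCurves.TianYuanZhang2017.W2
  Summit.BirchSwinnertonDyer.Rank1Residual.P2
  Summit.BirchSwinnertonDyer.PrintCf2.LevelTwoHalfGenerator
  Summit.BirchSwinnertonDyer.PrintCf2.LevelTwoDepth

set_option autoImplicit false

namespace Summit.BirchSwinnertonDyer.PrintCf2.LevelTwoTwoPrimes

/-! ## §1 Abstract bookkeeping: depth modulo torsion is insensitive to torsion and to even multiples -/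

section Abstract

variable {G : Type*} [AddCommGroup G]

/-- Points that differ by torsion have the same `2`-adic depth modulo torsion. [folklore] -/
theorem twoPowDivisible_iff_of_sub_isOfFinAddOrder {x x' : G} (h : IsOfFinAddOrder (x - x')) (k : ℕ) :
    (∃ y : G, IsOfFinAddOrder (x - ((2 : ℤ) ^ k) • y)) ↔ ∃ y : G, IsOfFinAddOrder (x' - ((2 : ℤ) ^ k) • y) := by
  constructor
  · rintro ⟨y, hy⟩
    refine ⟨y, ?_⟩
    have e : x' - ((2 : ℤ) ^ k) • y = (x - ((2 : ℤ) ^ k) • y) + -(x - x') := by abel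
    rw [e]
    exact hy.add h.neg
  · rintro ⟨y, hy⟩
    refine ⟨y, ?_⟩
    have e : x - ((2 : ℤ) ^ k) • y = (x - x') + (x' - ((2 : ℤ) ^ k) • y) := by abel
    rw [e]
    exact h.add hy

/-- `x ≡ z − c·a` modulo torsion with `c` EVEN: `[x] = [z]` in `G/(2G + G_tor)`. [folklore] -/
theorem twoDivisible_iff_of_even {x z a : G} {c : ℤ} (hc : Even c) (h : IsOfFinAddOrder (x - (z - c • a))) :
    (∃ y : G, IsOfFinAddOrder (x - (2 : ℤ) • y)) ↔ ∃ y : G, IsOfFinAddOrder (z - (2 : ℤ) • y) := by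
  obtain ⟨j, rfl⟩ := hc
  have h1 := twoPowDivisible_iff_of_sub_isOfFinAddOrder h 1
  simp only [pow_one] at h1
  rw [h1]
  constructor
  · rintro ⟨y, hy⟩
    refine ⟨y + j • a, ?_⟩
    have e : z - (2 : ℤ) • (y + j • a) = z - (j + j) • a - (2 : ℤ) • y := by module
    rwa [e]
  · rintro ⟨y, hy⟩
    refine ⟨y - j • a, ?_⟩
    have e : z - (j + j) • a - (2 : ℤ) • (y - j • a) = z - (2 : ℤ) • y := by module
    rwa [e]

/-- `x ≡ z − c·a` modulo torsion with `c` ODD: `[x] = [z − a]` in `G/(2G + G_tor)`. [folklore] -/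
theorem twoDivisible_iff_of_odd {x z a : G} {c : ℤ} (hc : Odd c) (h : IsOfFinAddOrder (x - (z - c • a))) :
    (∃ y : G, IsOfFinAddOrder (x - (2 : ℤ) • y)) ↔ ∃ y : G, IsOfFinAddOrder (z - a - (2 : ℤ) • y) := by
  obtain ⟨j, rfl⟩ := hc
  have h1 := twoPowDivisible_iff_of_sub_isOfFinAddOrder h 1
  simp only [pow_one] at h1
  rw [h1]
  constructor
  · rintro ⟨y, hy⟩
    refine ⟨y + j • a, ?_⟩
    have e : z - a - (2 : ℤ) • (y + j • a) = z - (2 * j + 1) • a - (2 : ℤ) • y := by module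
    rwa [e]
  · rintro ⟨y, hy⟩
    refine ⟨y - j • a, ?_⟩
    have e : z - (2 * j + 1) • a - (2 : ℤ) • (y - j • a) = z - a - (2 : ℤ) • y := by module
    rwa [e]

/-- Shifting a congruence `x ≡ w (mod 2G + G_tor)` by the same point `q`: `[x − q] = 0` iff `[w − q] = 0`. [folklore] -/
theorem twoDivisible_sub_iff {x w q : G} (hxw : ∃ v : G, IsOfFinAddOrder (x - w - (2 : ℤ) • v)) :
    (∃ y : G, IsOfFinAddOrder (x - q - (2 : ℤ) • y)) ↔ ∃ y : G, IsOfFinAddOrder (w - q - (2 : ℤ) • y) := by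
  obtain ⟨v, hv⟩ := hxw
  constructor
  · rintro ⟨y, hy⟩
    refine ⟨y - v, ?_⟩
    have e : w - q - (2 : ℤ) • (y - v) = (x - q - (2 : ℤ) • y) + -(x - w - (2 : ℤ) • v) := by abel
    rw [e]
    exact hy.add hv.neg
  · rintro ⟨y, hy⟩
    refine ⟨y + v, ?_⟩
    have e : x - q - (2 : ℤ) • (y + v) = (x - w - (2 : ℤ) • v) + (w - q - (2 : ℤ) • y) := by abel
    rw [e]
    exact hv.add hy

end Abstract

/-! ## §2 The recursion on the two-prime sector: `recursionIndex (lm) = {m}`, `P(m) = Z(m)`, `P(lm) = Z(lm) ∓ 𝓛(l)·Z(m)` -/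

section Recursion

variable {n : ℕ}

/-- `lm ≡ m (mod 8)` for `l ≡ 1 (mod 8)`. [folklore] -/
theorem mul_mod_eight_of_one {l m : ℕ} (hl8 : l % 8 = 1) : (l * m) % 8 = m % 8 := by
  rw [Nat.mul_mod, hl8, one_mul, Nat.mod_mod]

/-- **`recursionIndex (lm) = {m}`** for primes `l ≡ 1 (mod 8)`, `m ≡ 5` or `7 (mod 8)`: of the divisors `1, l, m, lm` only `d₀ = m`
has `d₀ ≡ 5, 6, 7` with cofactor `l ≡ 1 (mod 8)`, `l > 1`. [cite: TianYuanZhang2017, §3.1 (p0011 L67–L70)] -/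
theorem recursionIndex_two_primes {l m : ℕ} (hl : l.Prime) (hm : m.Prime) (hl8 : l % 8 = 1) (hm8 : m % 8 = 5 ∨ m % 8 = 7) :
    recursionIndex (l * m) = {m} := by
  have hlm : l * m / m = l := Nat.mul_div_cancel l hm.pos
  have hml : l * m / l = m := Nat.mul_div_cancel_left m hl.pos
  ext d₀
  simp only [recursionIndex, Finset.mem_filter, Nat.mem_divisors, Finset.mem_singleton]
  constructor
  · rintro ⟨⟨hd, -⟩, h567, h123, hgt⟩
    rcases (ThetaDescent.dvd_prime_mul_prime_iff hl hm).mp hd with rfl | rfl | rfl | rfl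
    · omega
    · omega
    · rfl
    · rw [Nat.div_self (Nat.mul_pos hl.pos hm.pos)] at hgt; omega
  · rintro rfl
    refine ⟨⟨Dvd.intro_left l rfl, Nat.mul_ne_zero hl.ne_zero hm.ne_zero⟩, by omega, ?_, ?_⟩
    · rw [hlm]; omega
    · rw [hlm]; exact hl.one_lt

/-- `[i]^e = ±1` on `A(ℍ′_n)` for EVEN `e` (`[i]² = [−1]`, `ThetaDescent.iPt_iPt`). [cite: TianYuanZhang2017, §3.1 (p0011 L66), Thm. 3.3 (p0011 L49–L51)] -/
theorem cmIPow_even_eq_sign_smul (D : GenusPointData n) {e : ℕ} (he : Even e) :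
    ∃ s : ℤ, (s = 1 ∨ s = -1) ∧ ∀ x : APoint D.H, cmIPow D.im D.im_sq e x = s • x := by
  obtain ⟨j, rfl⟩ := he
  induction j with
  | zero => exact ⟨1, Or.inl rfl, fun x => by simp [cmIPow]⟩
  | succ j ih =>
    obtain ⟨s, hs, h⟩ := ih
    refine ⟨-s, ?_, fun x => ?_⟩
    · rcases hs with rfl | rfl <;> norm_num
    · have e : j + 1 + (j + 1) = (j + j) + 1 + 1 := by ring
      rw [e]
      show D.iPt (D.iPt (cmIPow D.im D.im_sq (j + j) x)) = _
      rw [ThetaDescent.iPt_iPt, h, neg_smul]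

/-- **The recursion on the two-prime sector, EXACT in `A(ℍ′_{lm})`**: for primes `l ≡ 1 (mod 8)`, `m ≡ 5` or `7 (mod 8)` and `n = lm`,
`P(m) = Z(m)` and `P(lm) = Z(lm) − s·𝓛(l)·Z(m)` with `s = ±1` (`ε(m, l) = i^e`, `e` even since `(m, l) ≢ (5, 3) (mod 8)`).
[cite: TianYuanZhang2017, §3.1 (p0011 L67–L73), Thm. 3.3 (p0011 L49–L51)] -/
theorem P_eq_of_two_primes {l m : ℕ} (hl : l.Prime) (hm : m.Prime) (hl8 : l % 8 = 1) (hm8 : m % 8 = 5 ∨ m % 8 = 7)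
    (hn : n = l * m) (D : GenusPointData n) (hrec : D.recursion) (heps : D.epsSpec) :
    D.P m = D.Z m ∧ ∃ s : ℤ, (s = 1 ∨ s = -1) ∧ D.P n = D.Z n - s • (D.scriptL l • D.Z m) := by
  subst hn
  have hn0 : l * m ≠ 0 := Nat.mul_ne_zero hl.ne_zero hm.ne_zero
  have hlm : l * m / m = l := Nat.mul_div_cancel l hm.pos
  have hn8 : (l * m) % 8 = 5 ∨ (l * m) % 8 = 6 ∨ (l * m) % 8 = 7 := by
    rw [mul_mod_eight_of_one hl8]; rcases hm8 with h | h
    · exact Or.inl h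
    · exact Or.inr (Or.inr h)
  -- `P(m) = Z(m)`
  have hPm : D.P m = D.Z m := by
    have h := hrec m (Nat.mem_divisors.mpr ⟨Dvd.intro_left l rfl, hn0⟩)
      (by rcases hm8 with h | h
          · exact Or.inl h
          · exact Or.inr (Or.inr h))
    rw [ThetaDescent.recursionIndex_prime hm, Finset.sum_empty, sub_zero] at h
    exact h
  refine ⟨hPm, ?_⟩
  -- `P(lm) = Z(lm) − i^{eps m l} 𝓛(l) P(m)`, `eps m l` even
  have hP := hrec (l * m) (Nat.mem_divisors_self _ hn0) hn8
  rw [recursionIndex_two_primes hl hm hl8 hm8, Finset.sum_singleton, hlm, hPm] at hP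
  have he : Even (D.eps m l) := by
    rw [Nat.even_iff]
    by_contra hodd
    have h3 : m % 8 = 5 ∧ l % 8 = 3 := (heps m l).mp (by omega)
    omega
  obtain ⟨s, hs, hsx⟩ := cmIPow_even_eq_sign_smul D he
  exact ⟨s, hs, by rw [hP, hsx]⟩

end Recursion

/-! ## §3 `P(lm) ≡ Z(lm) − c·α_m` modulo torsion, `c = ±(𝓛(l)/2)·u·𝓛(m)` -/

section Congruence

variable {n : ℕ}

/-- **THE TWO-PRIME SECTOR OF THE GENUS-POINT DESCENT, ONE DIGIT BELOW PROP. 3.4.**  Primes `l ≡ 1 (mod 8)`, `m ≡ 5` or `7 (mod 8)`,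
`n = lm`; data `D` with the displayed recursion and `ε`-types; `𝓛(l) = 2c′` (Thm 1.1 at `l`); and Thm 3.5's main clause for the
divisor `m` read in `ℍ′_{lm}`: `2·P(m) − (u·𝓛(m))·α_m` torsion (`h35m`; `α_m ∈ A(ℍ′_{lm})` any point, in the intended reading a half of the
twisted generator of `E_m(ℚ)`).  Then for a sign `s = ±1`:
**`P(lm) − (Z(lm) − (s·c′·u·𝓛(m))·α_m)` has finite order** — the genus point of `lm` IS the genus period of `lm` corrected by an explicit
multiple of the prime twist's generator class, EXACTLY modulo torsion (not merely modulo `2A(ℍ′)` as in Prop. 3.4).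
[cite: TianYuanZhang2017, §3.1 (p0011 L67–L73), Thm. 3.5 (p0011 L94–L100), Thm. 1.1 (p0002 L90–L99)] -/
theorem genusPoint_two_primes_congr {l m : ℕ} (hl : l.Prime) (hm : m.Prime) (hl8 : l % 8 = 1) (hm8 : m % 8 = 5 ∨ m % 8 = 7)
    (hn : n = l * m) (D : GenusPointData n) (hrec : D.recursion) (heps : D.epsSpec)
    {c' : ℤ} (hLl : D.scriptL l = 2 * c') {αm : APoint D.H} {u : ℤ}
    (h35m : IsOfFinAddOrder ((2 : ℤ) • D.P m - (u * D.scriptL m) • αm)) :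
    ∃ s : ℤ, (s = 1 ∨ s = -1) ∧
      IsOfFinAddOrder (D.P n - (D.Z n - (s * c' * (u * D.scriptL m)) • αm)) := by
  obtain ⟨hPm, s, hs, hP⟩ := P_eq_of_two_primes hl hm hl8 hm8 hn D hrec heps
  refine ⟨s, hs, ?_⟩
  have e : D.P n - (D.Z n - (s * c' * (u * D.scriptL m)) • αm) =
      (-(s * c')) • ((2 : ℤ) • D.P m - (u * D.scriptL m) • αm) := by
    rw [hP, hLl, hPm]
    module
  rw [e]
  exact h35m.zsmul

/-- **Equal depth**: under the same hypotheses, for every `k`, `P(lm) ∈ 2^k A(ℍ′_{lm}) + tors ⟺ Z(lm) − c·α_m ∈ 2^k A(ℍ′_{lm}) + tors`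
(`c = s·c′·u·𝓛(m)`). [cite: TianYuanZhang2017, §3.1 (p0011 L67–L73), Thm. 3.5 (p0011 L94–L100)] -/
theorem twoPowDivisible_genusPoint_iff_two_primes {l m : ℕ} (hl : l.Prime) (hm : m.Prime) (hl8 : l % 8 = 1)
    (hm8 : m % 8 = 5 ∨ m % 8 = 7) (hn : n = l * m) (D : GenusPointData n) (hrec : D.recursion) (heps : D.epsSpec)
    {c' : ℤ} (hLl : D.scriptL l = 2 * c') {αm : APoint D.H} {u : ℤ}
    (h35m : IsOfFinAddOrder ((2 : ℤ) • D.P m - (u * D.scriptL m) • αm)) :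
    ∃ s : ℤ, (s = 1 ∨ s = -1) ∧ ∀ k : ℕ,
      ((∃ y : APoint D.H, IsOfFinAddOrder (D.P n - ((2 : ℤ) ^ k) • y)) ↔
        ∃ y : APoint D.H, IsOfFinAddOrder (D.Z n - (s * c' * (u * D.scriptL m)) • αm - ((2 : ℤ) ^ k) • y)) := by
  obtain ⟨s, hs, h⟩ := genusPoint_two_primes_congr hl hm hl8 hm8 hn D hrec heps hLl h35m
  exact ⟨s, hs, fun k => twoPowDivisible_iff_of_sub_isOfFinAddOrder h k⟩

/-- The coefficient `c = s·c′·u·𝓛(m)` is ODD iff `c′ = 𝓛(l)/2` is odd, when `𝓛(m)` is odd and `s, u = ±1` (the primes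
`m ≡ 5, 7 (mod 8)` have `𝓛(m)` odd: Thm 1.2 at `m`, `Σ₁(m) = g(m)` odd). [cite: TianYuanZhang2017, Thm. 1.2 (p0002 L112–L127)] -/
theorem odd_coeff_iff {s c' u L : ℤ} (hs : s = 1 ∨ s = -1) (hu : u = 1 ∨ u = -1) (hL : Odd L) :
    Odd (s * c' * (u * L)) ↔ Odd c' := by
  have hsu : Odd (s * u) := by
    rcases hs with rfl | rfl <;> rcases hu with rfl | rfl <;> decide
  have e : s * c' * (u * L) = c' * ((s * u) * L) := by ring
  rw [e, Int.odd_mul, Int.odd_mul]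
  tauto

end Congruence

/-! ## §4 C⁺ on the two-prime sector: one depth comparison between `Z(lm) − c·α_m` and the half `Q₁` of the generator -/

section LevelTwo

variable {n : ℕ}

/-- **C⁺ AT `n = lm` ⟺ `depth(Z(lm) − c·α_m) = depth(Q₁)` in `A(ℍ′_{lm})/tors`.**  Primes `l ≡ 1 (mod 8)`, `m ≡ 5` or `7 (mod 8)`,
`n = lm` with `ord_{s=1} L(E_n, s) = 1`; GZK; data `D` with Thm 3.5's displayed main clause at `n` (`h35`), integrality (`hLs`), the recursion
and the `ε`-types; `𝓛(l) = 2c′`; Thm 3.5 at `m` inside `ℍ′_n` (`h35m`); `R` a generator of `E_n(ℚ)` modulo torsion and `Q₁` any half of its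
twisted image (`φ_H(Q₁) = ι Θ_E(R)`).  Then for a sign `s = ±1`: the conclusion of C⁺ at `n` (`2 ∥ L` for every `L` with `𝓛(n)² = L²`)
holds **iff for every `k`, `Z(lm) − (s·c′·u·𝓛(m))·α_m ∈ 2^k A(ℍ′_n) + tors ⟺ Q₁ ∈ 2^k A(ℍ′_n) + tors`.**  (g3's
`levelTwo_iff_twoPowDivisible_iff_half` with `P(lm)` replaced through §3.)
[cite: TianYuanZhang2017, Thm. 3.5 (p0011 L94–L100), §3.1 (p0011 L67–L73)] [cite: Darmon2004, Thm. 3.22] [cite: SilvermanAEC2009, VIII.6] -/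
theorem levelTwo_two_primes_iff {l m : ℕ} (hl : l.Prime) (hm : m.Prime) (hl8 : l % 8 = 1) (hm8 : m % 8 = 5 ∨ m % 8 = 7)
    (hn : n = l * m) (hGZK : rank_eq_analyticRank_of_analyticRank_le_one) (hsq : Squarefree n)
    (hr : (congruentNumberCurve n).analyticRank = 1)
    (D : GenusPointData n) (h35 : D.thm35Main) (hLs : D.scriptLSpec) (hrec : D.recursion) (heps : D.epsSpec)
    {c' : ℤ} (hLl : D.scriptL l = 2 * c') {αm : APoint D.H} {u : ℤ}
    (h35m : IsOfFinAddOrder ((2 : ℤ) • D.P m - (u * D.scriptL m) • αm))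
    {R : (congruentNumberCurve n).toAffine.Point} (hR : ∀ x, ∃ k : ℤ, IsOfFinAddOrder (x - k • R))
    {Q₁ : APoint D.H} (hQ₁ : φH D Q₁ = Point.map (W' := curveA.twoIsogenyCodomain)
      (D.embK n (Nat.mem_divisors_self n hsq.ne_zero)) (ΘE hsq.ne_zero R)) :
    ∃ s : ℤ, (s = 1 ∨ s = -1) ∧
      ((∀ L : ℤ, IsScriptL n L → (2 : ℤ) ∣ L ∧ ¬ (4 : ℤ) ∣ L) ↔
        ∀ k : ℕ, ((∃ y : APoint D.H, IsOfFinAddOrder (D.Z n - (s * c' * (u * D.scriptL m)) • αm - ((2 : ℤ) ^ k) • y)) ↔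
          ∃ y : APoint D.H, IsOfFinAddOrder (Q₁ - ((2 : ℤ) ^ k) • y))) := by
  have h8 : n % 8 = 5 ∨ n % 8 = 6 ∨ n % 8 = 7 := by
    rw [hn, mul_mod_eight_of_one hl8]; rcases hm8 with h | h
    · exact Or.inl h
    · exact Or.inr (Or.inr h)
  obtain ⟨s, hs, hdepth⟩ := twoPowDivisible_genusPoint_iff_two_primes hl hm hl8 hm8 hn D hrec heps hLl h35m
  refine ⟨s, hs, ?_⟩
  rw [levelTwo_iff_twoPowDivisible_iff_half hGZK hsq h8 hr D h35 hLs hR hQ₁]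
  exact forall_congr' fun k => by rw [hdepth k]

end LevelTwo

/-! ## §5 Layer 1 (classes in `V = A(ℍ′_{lm})/(2A + tors)`): the bit `𝓛(l)/2 mod 2` decides whether `α_m` enters -/

section LayerOne

variable {n : ℕ}

/-- **`4 ∣ 𝓛(l)` ⟹ `[P(lm)] = [Z(lm)]` in `V`** (the correction `c·α_m` is an even multiple of `α_m`).
[cite: TianYuanZhang2017, §3.1 (p0011 L67–L73), Thm. 3.5 (p0011 L94–L100)] -/
theorem twoDivisible_genusPoint_iff_genusPeriod_of_four_dvd {l m : ℕ} (hl : l.Prime) (hm : m.Prime) (hl8 : l % 8 = 1)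
    (hm8 : m % 8 = 5 ∨ m % 8 = 7) (hn : n = l * m) (D : GenusPointData n) (hrec : D.recursion) (heps : D.epsSpec)
    (h4 : (4 : ℤ) ∣ D.scriptL l) {αm : APoint D.H} {u : ℤ}
    (h35m : IsOfFinAddOrder ((2 : ℤ) • D.P m - (u * D.scriptL m) • αm)) :
    (∃ y : APoint D.H, IsOfFinAddOrder (D.P n - (2 : ℤ) • y)) ↔
      ∃ y : APoint D.H, IsOfFinAddOrder (D.Z n - (2 : ℤ) • y) := by
  obtain ⟨c'', hc''⟩ := h4
  have hLl : D.scriptL l = 2 * (2 * c'') := by rw [hc'']; ring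
  obtain ⟨s, -, h⟩ := genusPoint_two_primes_congr hl hm hl8 hm8 hn D hrec heps hLl h35m
  have hev : Even (s * (2 * c'') * (u * D.scriptL m)) := ⟨s * c'' * (u * D.scriptL m), by ring⟩
  exact twoDivisible_iff_of_even hev h

/-- **`4 ∤ 𝓛(l)` (i.e. `𝓛(l)/2` odd, with `𝓛(m)` odd and `u = ±1`) ⟹ `[P(lm)] = [Z(lm) − α_m]` in `V`**: the generator class of the
prime twist `E_m` ENTERS the Layer-1 class of the genus point exactly when the bit `𝓛(l)/2 mod 2` is on.
[cite: TianYuanZhang2017, §3.1 (p0011 L67–L73), Thm. 3.5 (p0011 L94–L100), Thm. 1.2] -/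
theorem twoDivisible_genusPoint_iff_genusPeriod_sub_of_not_four_dvd {l m : ℕ} (hl : l.Prime) (hm : m.Prime) (hl8 : l % 8 = 1)
    (hm8 : m % 8 = 5 ∨ m % 8 = 7) (hn : n = l * m) (D : GenusPointData n) (hrec : D.recursion) (heps : D.epsSpec)
    {c' : ℤ} (hLl : D.scriptL l = 2 * c') (hc' : Odd c') (hLm : Odd (D.scriptL m)) {αm : APoint D.H} {u : ℤ}
    (hu : u = 1 ∨ u = -1) (h35m : IsOfFinAddOrder ((2 : ℤ) • D.P m - (u * D.scriptL m) • αm)) :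
    (∃ y : APoint D.H, IsOfFinAddOrder (D.P n - (2 : ℤ) • y)) ↔
      ∃ y : APoint D.H, IsOfFinAddOrder (D.Z n - αm - (2 : ℤ) • y) := by
  obtain ⟨s, hs, h⟩ := genusPoint_two_primes_congr hl hm hl8 hm8 hn D hrec heps hLl h35m
  exact twoDivisible_iff_of_odd ((odd_coeff_iff hs hu hLm).mpr hc') h

/-- **VISIBLE PART, `4 ∣ 𝓛(l)`: C⁺ at `lm` ⟺ `[Z(lm)] = [Q₁]`.**  Same data as `levelTwo_two_primes_iff`, the half `Q₁` NOT `2`-divisible modulo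
torsion (`hQ2`), and `4 ∣ 𝓛(l)`: then `2 ∥ 𝓛(lm)` **iff `Z(lm) − Q₁ ∈ 2A(ℍ′_{lm}) + tors`**.
[cite: TianYuanZhang2017, Thm. 3.5 (p0011 L94–L100), §3.1 (p0011 L67–L73)] [cite: Darmon2004, Thm. 3.22] -/
theorem levelTwo_two_primes_iff_visible_of_four_dvd {l m : ℕ} (hl : l.Prime) (hm : m.Prime) (hl8 : l % 8 = 1)
    (hm8 : m % 8 = 5 ∨ m % 8 = 7) (hn : n = l * m) (hGZK : rank_eq_analyticRank_of_analyticRank_le_one) (hsq : Squarefree n)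
    (hr : (congruentNumberCurve n).analyticRank = 1)
    (D : GenusPointData n) (h35 : D.thm35Main) (hLs : D.scriptLSpec) (hrec : D.recursion) (heps : D.epsSpec)
    (h4 : (4 : ℤ) ∣ D.scriptL l) {αm : APoint D.H} {u : ℤ}
    (h35m : IsOfFinAddOrder ((2 : ℤ) • D.P m - (u * D.scriptL m) • αm))
    {R : (congruentNumberCurve n).toAffine.Point} (hR : ∀ x, ∃ k : ℤ, IsOfFinAddOrder (x - k • R))
    {Q₁ : APoint D.H} (hQ₁ : φH D Q₁ = Point.map (W' := curveA.twoIsogenyCodomain)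
      (D.embK n (Nat.mem_divisors_self n hsq.ne_zero)) (ΘE hsq.ne_zero R))
    (hQ2 : ¬ ∃ y : APoint D.H, IsOfFinAddOrder (Q₁ - (2 : ℤ) • y)) :
    (∀ L : ℤ, IsScriptL n L → (2 : ℤ) ∣ L ∧ ¬ (4 : ℤ) ∣ L) ↔
      ∃ y : APoint D.H, IsOfFinAddOrder (D.Z n - Q₁ - (2 : ℤ) • y) := by
  have h8 : n % 8 = 5 ∨ n % 8 = 6 ∨ n % 8 = 7 := by
    rw [hn, mul_mod_eight_of_one hl8]; rcases hm8 with h | h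
    · exact Or.inl h
    · exact Or.inr (Or.inr h)
  rw [levelTwo_iff_genusPoint_sub_half_twoDivisible hGZK hsq h8 hr D h35 hLs hR hQ₁ hQ2]
  -- `[P(lm)] = [Z(lm)]`, shift both by `Q₁`
  obtain ⟨c'', hc''⟩ := h4
  have hLl : D.scriptL l = 2 * (2 * c'') := by rw [hc'']; ring
  obtain ⟨s, -, h⟩ := genusPoint_two_primes_congr hl hm hl8 hm8 hn D hrec heps hLl h35m
  refine twoDivisible_sub_iff ⟨-(s * c'' * (u * D.scriptL m)) • αm, ?_⟩
  have e : D.P n - D.Z n - (2 : ℤ) • (-(s * c'' * (u * D.scriptL m)) • αm) =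
      D.P n - (D.Z n - (s * (2 * c'') * (u * D.scriptL m)) • αm) := by module
  rwa [e]

/-- **VISIBLE PART, `4 ∤ 𝓛(l)`: C⁺ at `lm` ⟺ `[Z(lm)] = [Q₁] + [α_m]`.**  Same data, `Q₁` not `2`-divisible modulo torsion, `𝓛(l)/2` odd,
`𝓛(m)` odd, `u = ±1`: then `2 ∥ 𝓛(lm)` **iff `Z(lm) − α_m − Q₁ ∈ 2A(ℍ′_{lm}) + tors`**.
[cite: TianYuanZhang2017, Thm. 3.5 (p0011 L94–L100), §3.1 (p0011 L67–L73), Thm. 1.2] [cite: Darmon2004, Thm. 3.22] -/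
theorem levelTwo_two_primes_iff_visible_of_not_four_dvd {l m : ℕ} (hl : l.Prime) (hm : m.Prime) (hl8 : l % 8 = 1)
    (hm8 : m % 8 = 5 ∨ m % 8 = 7) (hn : n = l * m) (hGZK : rank_eq_analyticRank_of_analyticRank_le_one) (hsq : Squarefree n)
    (hr : (congruentNumberCurve n).analyticRank = 1)
    (D : GenusPointData n) (h35 : D.thm35Main) (hLs : D.scriptLSpec) (hrec : D.recursion) (heps : D.epsSpec)
    {c' : ℤ} (hLl : D.scriptL l = 2 * c') (hc' : Odd c') (hLm : Odd (D.scriptL m)) {αm : APoint D.H} {u : ℤ}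
    (hu : u = 1 ∨ u = -1) (h35m : IsOfFinAddOrder ((2 : ℤ) • D.P m - (u * D.scriptL m) • αm))
    {R : (congruentNumberCurve n).toAffine.Point} (hR : ∀ x, ∃ k : ℤ, IsOfFinAddOrder (x - k • R))
    {Q₁ : APoint D.H} (hQ₁ : φH D Q₁ = Point.map (W' := curveA.twoIsogenyCodomain)
      (D.embK n (Nat.mem_divisors_self n hsq.ne_zero)) (ΘE hsq.ne_zero R))
    (hQ2 : ¬ ∃ y : APoint D.H, IsOfFinAddOrder (Q₁ - (2 : ℤ) • y)) :
    (∀ L : ℤ, IsScriptL n L → (2 : ℤ) ∣ L ∧ ¬ (4 : ℤ) ∣ L) ↔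
      ∃ y : APoint D.H, IsOfFinAddOrder (D.Z n - αm - Q₁ - (2 : ℤ) • y) := by
  have h8 : n % 8 = 5 ∨ n % 8 = 6 ∨ n % 8 = 7 := by
    rw [hn, mul_mod_eight_of_one hl8]; rcases hm8 with h | h
    · exact Or.inl h
    · exact Or.inr (Or.inr h)
  rw [levelTwo_iff_genusPoint_sub_half_twoDivisible hGZK hsq h8 hr D h35 hLs hR hQ₁ hQ2]
  obtain ⟨s, hs, h⟩ := genusPoint_two_primes_congr hl hm hl8 hm8 hn D hrec heps hLl h35m
  have hodd : Odd (s * c' * (u * D.scriptL m)) := (odd_coeff_iff hs hu hLm).mpr hc'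
  obtain ⟨j, hj⟩ := hodd
  refine twoDivisible_sub_iff ⟨-j • αm, ?_⟩
  have e : D.P n - (D.Z n - αm) - (2 : ℤ) • (-j • αm) =
      D.P n - (D.Z n - (s * c' * (u * D.scriptL m)) • αm) := by rw [hj]; module
  rwa [e]

end LayerOne

end Summit.BirchSwinnertonDyer.PrintCf2.LevelTwoTwoPrimes

end
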